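import Literature.NumberTheory.Automorphic.ResGLnCohomology
import Literature.NumberTheory.Automorphic.ClozelAlgebraicity
import Literature.Barriers.Langlands.NonRegularWeightBarrier
import HarnessLib

/-!
# Cuspidal eigenclasses in the cohomology of `Res_{K/ℚ} GL_n` (named fact, any number field `K`)

Topic `NumberTheory/Automorphic`; namespace `Literature.NumberTheory.Automorphic`, grouping
sub-namespace `ResGLnCohomology` (that of the receptacle
`ResGLnCohomology.levelCohomology k n K 𝔫 λ q = H^q(GL_n(K)⁺, Fun(GL_n(𝔸_K^∞)/K_f(𝔫), E_λ(k)))`,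
`E_λ = ⊗_{τ : K →+* k} V_{λ_τ}`, with its unramified Hecke operators `heckeT … v i = T_{v,i}`,
`ResGLnCohomology.lean`).  ONE NAMED FACT (`def … : Prop`, D-0014), the general-`K` twin of the
tree's `GLnCohomology.cuspidalEigenclass_exists` (`CuspidalCohomologyGL.lean`, `K = ℚ`):

* `ResGLnCohomology.cuspidalEigenclass_exists` — for `n ≥ 1`, a level `𝔫 ≠ 0` and a weight
  `λ = (λ_τ)_{τ : K →+* ℂ}` with every `λ_τ` dominant: every cuspidal automorphic representation `π`
  of `GL_n(𝔸_K)` whose infinity type has, at every embedding `τ`, the `a`-multiset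
  `{λ_τ^∨_i + ρ_i}` of the cohomological type of `λ_τ^∨` (`cohomologicalInfinityType n K λ_τ^∨ τ`;
  only the `a`-multisets are read, as everywhere in the tree, and the weight genuinely depends on `τ`
  over a general `K`), and which has a `K(𝔫)`-fixed vector off `W'`, has a non-zero class `x` in some
  `H^q(S_{K_f(𝔫)}, Ẽ_λ)` which is a simultaneous eigenclass of the `T_{v,i}`, `v ∤ 𝔫`, `0 ≤ i ≤ n`,
  with the eigenvalues `t_{v,i} = q_v^{i(n−i)/2} e_i(α_v)` (`heckeEigenvalueOf`) of the Satake
  parameters `α_v` of `π`.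

## What is printed, and where

* Clozel 1990, Lemme 3.14 (p. 120): for `π` cuspidal, `π_∞` is regular algebraic iff
  `H^•(𝔤, K_∞; π_∞ ⊗ M) ≠ 0` for some algebraic representation `M` of `Res_{K/ℚ} GL_n`; Lemme 3.15
  and §3.5 (pp. 121–123): `π_f ⊗ H^•(𝔤, K_∞; π_∞ ⊗ M) ↪ H^•_cusp(S̃, M̃) ⊆ H^•(S̃, M̃)`
  Hecke-equivariantly, `S̃ = lim S_{K_f}` the adelic locally symmetric spaces of `Res_{K/ℚ} GL_n`.
* Borel 1983 (Duke 50), Thm. 5.3 and Cor. 5.5 ("regularization"): the inclusion of cusp forms induces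
  an INJECTION `H^•(𝔤, K; 𝒜_cusp ⊗ E) ↪ H^•(Γ, E) = H^•(𝔤, K; C^∞(Γ\G) ⊗ E)` for every arithmetic `Γ`
  and every finite-dimensional `E`; Franke 1998, Thm. 18 (the automorphic description of all of
  `H^•(S_{K_f}, Ẽ)`) contains it.
* Grobner–Raghuram 2014, §7.2–§7.3 (arXiv:1102.1872): the same for `GL_m/D` over any number field,
  with the coefficient systems `E_μ = ⊗_v E_{μ_v}` (one highest weight per embedding) and the action of
  `π₀`/signs handled through `GL_n(K)⁺`-type components, as in the tree's carrier.
* The eigenvalue of the double coset `T_{v,i} = [K_f(𝔫) diag(ϖ_v×i, 1×(n−i)) K_f(𝔫)]`, `v ∤ 𝔫`, on the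
  spherical line of `π_v` is `q_v^{i(n−i)/2} e_i(α_v)` (Satake–Tamagawa) — in the tree this is the
  DEFINITION of "`π` has Satake parameter `α_v` at `v`" (`AutomorphicRepData.HasSatakeParamAt`), so the
  Hecke clause below only expresses the equivariance of the realisation map for the integral double-coset
  operators (`TwistedQuotient.heckeEnd` sums `f(x h K_f)` over `h K_f ⊆ K_f g K_f`, the formula of the
  automorphic `heckeOperator (rightTranslation …)`).
* Carrier: `S_{K_f} = GL_n(K)\(X × G(𝔸_f)/K_f) = GL_n(K)⁺\(X⁺ × G(𝔸_f)/K_f)`, `X = G(ℝ)/K_∞°A_G` with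
  `A_G = ℝ_{>0}` the `ℚ`-split part of the centre (the tree's automorphic forms live on
  `A_G GL_n(K)\GL_n(𝔸_K)`), `X⁺` contractible with finite isotropy, so that in characteristic `0` the
  sheaf cohomology is the group cohomology of the twisted module — the model of `ResGLnCohomology.lean`
  (Schwermer 2010, §5.1, §5.3), exactly as for `GLnCohomology.levelCohomology` over `ℚ`.

## Lean rendering and design

Hypotheses mirror the `ℚ`-twin: `1 ≤ n`; the level is an ideal `𝔫 ≠ 0` of `𝓞 K` (`K_f(𝔫) =
finitePrincipalCongruenceLevel`, the `level` of the carrier) instead of an integer `N ≥ 1`; the weight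
is a family `lam : (K →+* ℂ) → Fin n → ℤ` of dominant weights (`Weight.IsDominant`, the tree's
`GLHighestWeight`); the archimedean hypothesis is stated on `a`-multisets embedding by embedding
(`∃ T, π.HasInfinityType T ∧ ∀ τ, (T τ).map a = (cohomologicalInfinityType n K (lam τ)^∨ τ).map a`),
which is what Clozel's Lemme 3.14 delivers for a regular algebraic `π` over any `K`
(`InfinityType.IsRegularAlgebraic.exists_isDominant_forall_map_a_eq_cohomological`,
`ClozelCohomologicalTypeProofs.lean`) and avoids building a `σ`-dependent `InfinityType` (whose
well-formedness at conjugate embeddings would need purity); the conclusion is in SOME degree `q` of the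
FULL cohomology (weaker than the `ℚ`-twin's interior class in the bottom degree; the Hecke-field
argument `Clozel1990_heckeEigenvalueField_of_resRealisation` needs no more).  Nothing is proved here;
users take `(h : ResGLnCohomology.cuspidalEigenclass_exists)`.  Consumers: the crux
`Summit.Langlands.Langlands.Theses.IrreducibilityBySelfDuality.HeckeEigenvalueField`
(= `Clozel1990_heckeEigenvalueField`) through `Clozel1990_heckeEigenvalueField_of_resRealisation`
(`ClozelAlgebraicityHeckeFieldResProofs.lean`), whose hypothesis `hE` is this fact ∘ Lemme 3.14 ∘
`AutomorphicRepData.exists_principalCongruenceLevel_fixed`.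

Mathlib / tree search: `lean search 'cuspidalEigenclass_exists'` — only the `ℚ`-twin
`GLnCohomology.cuspidalEigenclass_exists` and its consumers; nothing on `ResGLnCohomology` beyond
`ResGLnCohomology.lean`, `ResGLnAdelicCoefficients.lean`, `ResGLnCoeffIntegralForm.lean`,
`ClozelAlgebraicityHeckeFieldResProofs.lean`.

## References

* L. Clozel, *Motifs et formes automorphes: applications du principe de fonctorialité*, in:
  Automorphic forms, Shimura varieties, and L-functions I (Ann Arbor 1988), Perspect. Math. 10,
  Academic Press 1990: Lemme 3.14, Lemme 3.15, §3.5 (pp. 120–123). [Clozel1990]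
* A. Borel, *Regularization theorems in Lie algebra cohomology. Applications*, Duke Math. J. 50
  (1983), Thm. 5.3, Cor. 5.5. [Borel1983Regularization]
* J. Franke, *Harmonic analysis in weighted L₂-spaces*, Ann. Sci. ÉNS 31 (1998), Thm. 18. [Franke1998]
* H. Grobner, A. Raghuram, Int. J. Number Theory 10 (2014) = arXiv:1102.1872, §7.2–§7.3. [GrobnerRaghuram2014]
* J. Schwermer, Bull. AMS 47 (2010), §5.1, §5.3, §13.2. [Schwermer2010]
-/

noncomputable section

open scoped Classical
open NumberField IsDedekindDomain

namespace Literature.NumberTheory.Automorphic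

namespace ResGLnCohomology

open Literature.NumberTheory.DiophantineGeometry Literature.Barriers.Langlands

/-- NAMED FACT — **cuspidal eigenclasses in the cohomology of `Res_{K/ℚ} GL_n` (Clozel, Lemme 3.15 /
Borel's injectivity of cuspidal into full cohomology), any number field `K`.**  For `n ≥ 1`, an ideal
`𝔫 ≠ 0` of `𝓞 K` and a family `λ = (λ_τ)_{τ : K →+* ℂ}` of dominant integral weights: every cuspidal
automorphic representation `π` of `GL_n(𝔸_K)` having an infinity type whose `a`-multiset at every
embedding `τ` is that of the cohomological type of `λ_τ^∨ = Weight.dual (λ τ)` (Harish-Chandra parameter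
`λ_τ^∨ + ρ` at `τ`, i.e. `π_∞ ⊗ E_λ` has the infinitesimal character of the trivial representation),
and having a `K(𝔫)`-fixed form off `W'`, has, in some degree `q`, a non-zero class
`x ∈ H^q(S_{K_f(𝔫)}, Ẽ_λ) = ResGLnCohomology.levelCohomology ℂ n K 𝔫 λ q` with
`T_{v,i} x = q_v^{i(n−i)/2} e_i(α_v) • x` for every `v ∤ 𝔫`, every Satake parameter `α_v` of `π` at `v`
and every `i ≤ n`.  Printed: `π_f^{K_f} ⊗ H^q(𝔤, K_∞; π_∞ ⊗ E_λ) ↪ H^q_cusp ⊆ H^q(S_{K_f}, Ẽ_λ)`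
Hecke-equivariantly [cite: Clozel1990, Lemme 3.15 and §3.5 (pp. 121–123)]
[cite: Borel1983Regularization, Thm. 5.3 and Cor. 5.5] [cite: Franke1998, Thm. 18]
[cite: GrobnerRaghuram2014, §7.2–7.3 (arXiv:1102.1872 numbering)], with
`H^•(𝔤, K_∞; π_∞ ⊗ E_λ) ≠ 0` for `π_∞` of that infinitesimal character [cite: Clozel1990, Lemme 3.14];
the twin over `ℚ` is `GLnCohomology.cuspidalEigenclass_exists`.  Unproved in the tree; users take
`(h : ResGLnCohomology.cuspidalEigenclass_exists)`. -/
def cuspidalEigenclass_exists : Prop :=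
  ∀ (n : ℕ) (K : Type) [Field K] [NumberField K] (hcpt : isCompact_glFiniteIntegralLevel n K)
    (𝔫 : Ideal (𝓞 K)) (lam : (K →+* ℂ) → Fin n → ℤ), 1 ≤ n → 𝔫 ≠ 0 →
    (∀ τ, Weight.IsDominant (lam τ)) →
    ∀ π : CuspidalAutomorphicRepData n K hcpt,
      (∃ T : InfinityType K n, π.1.HasInfinityType T ∧
        ∀ τ : K →+* ℂ, (T τ).map ArchWeight.a =
          (cohomologicalInfinityType n K (Weight.dual (lam τ)) τ).map ArchWeight.a) →
      (∃ φ ∈ π.1.W, φ ∉ π.1.W' ∧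
        ∀ u ∈ principalCongruenceLevel n K 𝔫, rightTranslation (AdelicGroupData.gl n K) u φ = φ) →
      ∃ (q : ℕ) (x : levelCohomology ℂ n K 𝔫 lam q), x ≠ 0 ∧
        ∀ v : HeightOneSpectrum (𝓞 K), ¬ v.asIdeal ∣ 𝔫 → ∀ α : Multiset ℂ,
          π.1.HasSatakeParamAt v α → ∀ i ≤ n,
            heckeT ℂ n K 𝔫 lam q v i x = heckeEigenvalueOf n v α i • x

end ResGLnCohomology

end Literature.NumberTheory.Automorphic

end
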